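import Mathlib
import Summits.ValiantsHypothesis.ValiantsHypothesis.Theorems.GrenetZeonTwoDimCoefficientsDualUnipotentStaircase

/-!
# Crux `GrenetZeon.TwoDimCoefficients` (stmt-ValiantsHypothesis-8062) / rung `DualUnipotentThreeHalves`
# (stmt-ValiantsHypothesis-24318): the staircase / row-block bounds over ARBITRARY index types and with the
# monotonicities SWAPPED — the exact shape consumed by the ambient port of «(H) on the layered family»

✓ `…DualUnipotentStaircase` (§1–§3) states the staircase lemma for `Fin p`/`Fin q`-indexed matrices with
`R` monotone and `C` antitone.  The port plan (note `HESSIAN-RATE-LAYERED.md` §8) works in the ambient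
`Matrix ι ι K` and meets the chains the other way round (column spaces of the leaving products `M_j`
DEcrease, row spaces of the arriving products `O_j` INcrease along `j`).  This file supplies exactly that:

* `finrank_span_vecMulVec_le'` — `dim span{x yᵀ : x ∈ R, y ∈ C} ≤ dim R · dim C` for any finite index types;
* ★ `finrank_iSup_span_vecMulVec_le_of_antitone_monotone_of_le` — STAIRCASE, general index types, `R`
  ANTITONE inside `X`, `C` MONOTONE inside `Y`, at each index one of `dim R_s ≤ t`, `dim C_s ≤ t`:
  `dim Σ_s R_s ⊗ C_s ≤ t·(dim X + dim Y)`;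
* ★ `finrank_span_mul_mul_le_of_antitone_monotone_of_le` — ROW-BLOCK BOUND in product form: all products
  `M j · X' · O j` (`j < k`, `X'` arbitrary), with the columns of `M j` in `R_j` and the rows of `O j` in `C_j`,
  span `≤ t·(dim X + dim Y)` dimensions.

HONEST FRAMING: def-free linear algebra (any field), an ingredient of a port that is NOT completed here;
nothing about the stubs, 24318, (c) or `VP ≠ VNP` is proved.
-/

-- single-conjunct layout `Summits/ValiantsHypothesis/ValiantsHypothesis`: the duplicated namespace
-- component is mandated by the tree.
set_option linter.dupNamespace false

noncomputable section

namespace Summit.ValiantsHypothesis.ValiantsHypothesis.Cruxes.TwoDimCoefficients.DimTwoCases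

open Matrix

variable {K : Type*} [Field K] {ρ σ : Type*} [Fintype ρ] [Fintype σ]

/-- `dim span{x yᵀ : x ∈ R, y ∈ C} ≤ dim R · dim C`, any finite index types. [folklore] -/
theorem finrank_span_vecMulVec_le' (R : Submodule K (ρ → K)) (C : Submodule K (σ → K)) :
    Module.finrank K (Submodule.span K
      {M : Matrix ρ σ K | ∃ x ∈ R, ∃ y ∈ C, M = vecMulVec x y}) ≤
      Module.finrank K R * Module.finrank K C := by
  let B : R →ₗ[K] C →ₗ[K] Matrix ρ σ K :=
    LinearMap.mk₂ K (fun x y => vecMulVec (x : ρ → K) (y : σ → K))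
      (fun x x' y => by simp only [Submodule.coe_add, add_vecMulVec])
      (fun c x y => by simp only [Submodule.coe_smul, smul_vecMulVec])
      (fun x y y' => by simp only [Submodule.coe_add, vecMulVec_add])
      (fun c x y => by simp only [Submodule.coe_smul, vecMulVec_smul])
  have hle : Submodule.span K {M : Matrix ρ σ K | ∃ x ∈ R, ∃ y ∈ C, M = vecMulVec x y} ≤
      LinearMap.range (TensorProduct.lift B) := by
    refine Submodule.span_le.mpr ?_
    rintro M ⟨x, hx, y, hy, rfl⟩
    exact ⟨⟨x, hx⟩ ⊗ₜ ⟨y, hy⟩, by simp only [TensorProduct.lift.tmul, B, LinearMap.mk₂_apply]⟩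
  calc Module.finrank K _ ≤ Module.finrank K (LinearMap.range (TensorProduct.lift B)) :=
        Submodule.finrank_mono hle
    _ ≤ Module.finrank K (TensorProduct K R C) := LinearMap.finrank_range_le _
    _ = Module.finrank K R * Module.finrank K C := Module.finrank_tensorProduct

/-- **STAIRCASE LEMMA** (general index types; `R` antitone, `C` monotone, relative to `X`, `Y`).
[folklore] -/
theorem finrank_iSup_span_vecMulVec_le_of_antitone_monotone_of_le {k t : ℕ}
    (R : Fin k → Submodule K (ρ → K)) (C : Fin k → Submodule K (σ → K))
    (X : Submodule K (ρ → K)) (Y : Submodule K (σ → K))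
    (hRX : ∀ s, R s ≤ X) (hCY : ∀ s, C s ≤ Y) (hR : Antitone R) (hC : Monotone C)
    (ht : ∀ s, Module.finrank K (R s) ≤ t ∨ Module.finrank K (C s) ≤ t) :
    Module.finrank K (⨆ s, Submodule.span K
      {M : Matrix ρ σ K | ∃ x ∈ R s, ∃ y ∈ C s, M = vecMulVec x y} :
        Submodule K (Matrix ρ σ K)) ≤
      t * (Module.finrank K X + Module.finrank K Y) := by
  classical
  -- indices where `R` is small form an UP-set (R antitone); take its FIRST element
  set D : Finset (Fin k) := Finset.univ.filter fun s => Module.finrank K (R s) ≤ t with hD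
  set U : Finset (Fin k) := Finset.univ.filter fun s => ¬ Module.finrank K (R s) ≤ t with hU
  let Rstar : Submodule K (ρ → K) := ⨆ s ∈ D, R s
  let Cstar : Submodule K (σ → K) := ⨆ s ∈ U, C s
  have hRstar : Module.finrank K Rstar ≤ t := by
    by_cases h : D.Nonempty
    · have hmem := Finset.min'_mem D h
      simp only [hD, Finset.mem_filter, Finset.mem_univ, true_and] at hmem
      refine le_trans (Submodule.finrank_mono ?_) hmem
      exact iSup₂_le fun s hs => hR (Finset.min'_le D s (by rw [hD]; exact hs))
    · have hbot : Rstar ≤ ⊥ := iSup₂_le fun s hs => absurd ⟨s, hs⟩ h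
      have h0 := Submodule.finrank_mono hbot
      rw [finrank_bot] at h0
      exact h0.trans (Nat.zero_le _)
  have hCstar : Module.finrank K Cstar ≤ t := by
    by_cases h : U.Nonempty
    · have hmem := Finset.max'_mem U h
      simp only [hU, Finset.mem_filter, Finset.mem_univ, true_and] at hmem
      have hC' : Module.finrank K (C (U.max' h)) ≤ t := (ht (U.max' h)).resolve_left (by
        convert hmem using 3)
      refine le_trans (Submodule.finrank_mono ?_) hC'
      exact iSup₂_le fun s hs => hC (Finset.le_max' U s (by rw [hU]; exact hs))
    · have hbot : Cstar ≤ ⊥ := iSup₂_le fun s hs => absurd ⟨s, hs⟩ h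
      have h0 := Submodule.finrank_mono hbot
      rw [finrank_bot] at h0
      exact h0.trans (Nat.zero_le _)
  have hRle : ∀ s, Module.finrank K (R s) ≤ t → R s ≤ Rstar := by
    intro s hs
    have hsD : s ∈ D := by
      simp only [hD, Finset.mem_filter, Finset.mem_univ, true_and]; exact hs
    exact le_iSup₂ (f := fun s' (_ : s' ∈ D) => R s') s hsD
  have hCle : ∀ s, ¬ Module.finrank K (R s) ≤ t → C s ≤ Cstar := by
    intro s hs
    have hsU : s ∈ U := by
      simp only [hU, Finset.mem_filter, Finset.mem_univ, true_and]; exact hs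
    exact le_iSup₂ (f := fun s' (_ : s' ∈ U) => C s') s hsU
  set SL := Submodule.span K
    {M : Matrix ρ σ K | ∃ x ∈ Rstar, ∃ y ∈ Y, M = vecMulVec x y} with hSL
  set SR := Submodule.span K
    {M : Matrix ρ σ K | ∃ x ∈ X, ∃ y ∈ Cstar, M = vecMulVec x y} with hSR
  have hsup : (⨆ s, Submodule.span K
      {M : Matrix ρ σ K | ∃ x ∈ R s, ∃ y ∈ C s, M = vecMulVec x y} :
        Submodule K (Matrix ρ σ K)) ≤ SL ⊔ SR := by
    refine iSup_le fun s => ?_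
    by_cases hs : Module.finrank K (R s) ≤ t
    · refine le_sup_left.trans' (Submodule.span_mono ?_)
      rintro M ⟨x, hx, y, hy, rfl⟩
      exact ⟨x, hRle s hs hx, y, hCY s hy, rfl⟩
    · refine le_sup_right.trans' (Submodule.span_mono ?_)
      rintro M ⟨x, hx, y, hy, rfl⟩
      exact ⟨x, hRX s hx, y, hCle s hs hy, rfl⟩
  have hsum : Module.finrank K ↥(SL ⊔ SR) ≤ Module.finrank K SL + Module.finrank K SR := by
    have := Submodule.finrank_sup_add_finrank_inf_eq SL SR
    omega
  calc Module.finrank K _ ≤ Module.finrank K ↥(SL ⊔ SR) := Submodule.finrank_mono hsup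
    _ ≤ Module.finrank K SL + Module.finrank K SR := hsum
    _ ≤ Module.finrank K Rstar * Module.finrank K Y + Module.finrank K X * Module.finrank K Cstar :=
        Nat.add_le_add (finrank_span_vecMulVec_le' Rstar Y) (finrank_span_vecMulVec_le' X Cstar)
    _ ≤ t * Module.finrank K Y + Module.finrank K X * t :=
        Nat.add_le_add (Nat.mul_le_mul_right _ hRstar) (Nat.mul_le_mul_left _ hCstar)
    _ = t * (Module.finrank K X + Module.finrank K Y) := by ring

omit [Fintype ρ] [Fintype σ] in
/-- A product `M·X'·O` is the `X'`-weighted sum of the outer products (column `c` of `M`) ⊗ (row `e` of `O`).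
[folklore] -/
theorem mul_mul_eq_sum_vecMulVec {κ μ : Type*} [Fintype κ] [Fintype μ]
    (M : Matrix ρ κ K) (O : Matrix μ σ K) (X' : Matrix κ μ K) :
    M * X' * O = ∑ c, ∑ e, X' c e • vecMulVec (fun a => M a c) (fun b => O e b) := by
  ext a b
  simp only [Matrix.mul_apply, Matrix.sum_apply, Matrix.smul_apply, vecMulVec_apply, smul_eq_mul,
    Finset.sum_mul]
  conv_lhs => rw [Finset.sum_comm]
  refine Finset.sum_congr rfl fun c _ => Finset.sum_congr rfl fun e _ => by ring

/-- **ROW-BLOCK BOUND, product form** (note §8 step (4)): if the columns of every `M j` lie in the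
ANTITONE chain `R ≤ X` and the rows of every `O j` in the MONOTONE chain `C ≤ Y`, one of the two of
dimension `≤ t` at each `j`, then all products `M j · X' · O j` span `≤ t·(dim X + dim Y)` dimensions.
[folklore] -/
theorem finrank_span_mul_mul_le_of_antitone_monotone_of_le {k t : ℕ} {κ μ : Fin k → Type*}
    [∀ j, Fintype (κ j)] [∀ j, Fintype (μ j)]
    (M : (j : Fin k) → Matrix ρ (κ j) K) (O : (j : Fin k) → Matrix (μ j) σ K)
    (R : Fin k → Submodule K (ρ → K)) (C : Fin k → Submodule K (σ → K))
    (X : Submodule K (ρ → K)) (Y : Submodule K (σ → K))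
    (hRX : ∀ s, R s ≤ X) (hCY : ∀ s, C s ≤ Y) (hR : Antitone R) (hC : Monotone C)
    (hM : ∀ j c, (fun a => M j a c) ∈ R j) (hO : ∀ j e, (fun b => O j e b) ∈ C j)
    (ht : ∀ j, Module.finrank K (R j) ≤ t ∨ Module.finrank K (C j) ≤ t) :
    Module.finrank K (Submodule.span K {Z : Matrix ρ σ K |
      ∃ j, ∃ X' : Matrix (κ j) (μ j) K, Z = M j * X' * O j}) ≤
      t * (Module.finrank K X + Module.finrank K Y) := by
  have hle : Submodule.span K {Z : Matrix ρ σ K | ∃ j, ∃ X' : Matrix (κ j) (μ j) K, Z = M j * X' * O j} ≤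
      (⨆ s, Submodule.span K
        {N : Matrix ρ σ K | ∃ x ∈ R s, ∃ y ∈ C s, N = vecMulVec x y} :
          Submodule K (Matrix ρ σ K)) := by
    refine Submodule.span_le.mpr ?_
    rintro Z ⟨j, X', rfl⟩
    rw [mul_mul_eq_sum_vecMulVec]
    refine Submodule.sum_mem _ fun c _ => Submodule.sum_mem _ fun e _ => Submodule.smul_mem _ _ ?_
    exact Submodule.mem_iSup_of_mem j (Submodule.subset_span ⟨_, hM j c, _, hO j e, rfl⟩)
  exact (Submodule.finrank_mono hle).trans
    (finrank_iSup_span_vecMulVec_le_of_antitone_monotone_of_le R C X Y hRX hCY hR hC ht)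

end Summit.ValiantsHypothesis.ValiantsHypothesis.Cruxes.TwoDimCoefficients.DimTwoCases

end
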